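import Summits.HodgeConjecture.HodgeConjecture.Theses.BoundaryReadout
import Literature.AlgebraicGeometry.HodgeTheory.ComplexConjugationHolds
import Literature.AlgebraicGeometry.HodgeTheory.HodgeTypeExteriorProduct

/-!
# `BoundaryAbsoluteness` (stmt-HodgeConjecture-15913) · Negative · HC-safety and the chart lower bound

Negative-side knowledge for the crux `BoundaryReadout.BoundaryAbsoluteness` (route
`BoundaryReadout`, rank 3: boundary Principle B — for `f : 𝒳 → C` onto a smooth projective curve, a
global rational `(p,p)` class `ξ` whose restrictions to finitely many smooth projective pieces `Y_i`
covering ONE fibre `X_o` are absolute Hodge has absolute Hodge restriction `ξ|X_t` to every smooth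
projective fibre), from the refuter's crux attack (refuter-rattack-stmt-HodgeConjecture-15913-0,
2026-08-17). All sorry-free; no definition is declared (printed inputs the tree lacks are explicit
hypotheses, spelled out in each signature).

* `boundaryAbsoluteness_of_hodgeIsAbsolute`: Charles–Schnell Conj. 11.2.17 on the tree's carriers
  ("every rational `(p,p)` class on a smooth projective complex variety is absolute Hodge") implies the
  crux WITHOUT using any boundary hypothesis (surjectivity, covering pieces, their absoluteness, the
  curve base): the conclusion is an instance, `ξ|X_t` being rational (`IsRationalClass.pullback`) and of
  type `(p,p)` (`IsOfHodgeType.map_of_isSmoothProjective`, proved). So the crux is sandwiched between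
  Conj. 11.2.17 and its special case; its content is exactly an unconditional proof of that case.
* `boundaryAbsoluteness_of_hodgeConjecture`: `S → C` modulo "cycle classes are absolute Hodge"
  (Charles–Schnell §11.2.2 after Def. 11.2.3; Deligne 1982, Ex. 2.1(a); not in the tree).
* `not_hodgeConjecture_of_not_boundaryAbsoluteness`: contrapositive — an unconditional `¬ C` landed in
  the tree refutes the summit, granting cycle classes absolute Hodge. The crux is HC-SAFE: refutable only
  by a counterexample to HC, or by junk in `IsAbsoluteHodgeClass` that would equally break
  cycle-classes-AH. (The route header's kill criterion (i) "a leak in the ℚ-structures" cannot occur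
  for the statement AS TYPED: hypotheses and conclusion are `IsAbsoluteHodgeClass` on smooth projective
  schemes, and the conclusion alone already follows from 11.2.17.)
* `nonempty_conjugationChart_fibre_of_boundaryAbsoluteness`: WHAT ANY PROOF MUST BUILD — fed the zero
  class, the crux turns "`0` is absolute Hodge on each covering piece `Y_i`" into a
  `ConjugationChart σ X_t (2p)` for every smooth projective fibre and every `σ ∈ Aut ℂ` (the line's
  `stub_conjugate_exists`; no chart is constructed in the tree today).

References: Charles–Schnell 2014, §11.2.2, Def. 11.2.3, Conj. 11.2.17; Deligne 1982 (LNM 900), §2.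
-/

open CategoryTheory
open Literature.AlgebraicGeometry Literature.AlgebraicGeometry.HodgeTheory
  Literature.AlgebraicGeometry.Motives

namespace Summit.HodgeConjecture.HodgeConjecture.Theorems.BoundaryAbsoluteness.Negative

open Summit.HodgeConjecture.HodgeConjecture.Theses.BoundaryReadout

/-- **Conj. 11.2.17 ⟹ the crux, boundary hypotheses unused.** If every rational `(p,p)` class on
every smooth projective complex variety is absolute Hodge (Charles–Schnell Conj. 11.2.17 on the tree's
carriers), then `BoundaryAbsoluteness` holds — the restriction `ξ|X_t` is rational
(`IsRationalClass.pullback`) and of type `(p,p)` (`IsOfHodgeType.map_of_isSmoothProjective`).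
[cite: CharlesSchnell2014Notes, §11.2.5 Conj. 11.2.17] -/
theorem boundaryAbsoluteness_of_hodgeIsAbsolute
    (hHA : ∀ ⦃n : ℕ⦄ ⦃X : SchemeOver ℂ⦄, IsSmoothProjective n X →
      ∀ (p : ℕ) (c : complexBetti X (2 * p)), IsRationalClass c → IsOfHodgeType n X (2 * p) p p c →
        IsAbsoluteHodgeClass n X p c) :
    BoundaryAbsoluteness := by
  intro N p 𝒳 C f o h𝒳 _hC _hf ι _ m Y g _hY _hcov ξ hξr hξh _habs t n ht
  exact hHA ht p _ (hξr.pullback (AlgPoints.mapContinuous (L := ℂ) (fiberι f t)))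
    (hξh.map_of_isSmoothProjective ht h𝒳 (fiberι f t))

/-- **`S → C` modulo cycle classes absolute Hodge.** The Hodge conjecture together with "cycle classes
are absolute Hodge" (Charles–Schnell §11.2.2 after Def. 11.2.3; Deligne 1982, Ex. 2.1(a)) implies the
crux. [cite: CharlesSchnell2014Notes, §11.2.2] -/
theorem boundaryAbsoluteness_of_hodgeConjecture
    (hAH : ∀ ⦃n : ℕ⦄ ⦃X : SchemeOver ℂ⦄, IsSmoothProjective n X →
      ∀ (p : ℕ) (c : complexBetti X (2 * p)), IsRationalClass c → IsOfHodgeType n X (2 * p) p p c →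
        c ∈ algebraicClasses X p → IsAbsoluteHodgeClass n X p c)
    (hHC : _root_.HodgeConjecture) : BoundaryAbsoluteness :=
  boundaryAbsoluteness_of_hodgeIsAbsolute
    fun _n _X hX p c hc hh ↦ hAH hX p c hc hh ((hHC hX).2 p c hc hh)

/-- **A kill of the crux is a disproof of the Hodge conjecture** (granting cycle classes absolute
Hodge): the crux is HC-safe, refutable only by a rational Hodge class that is not absolute Hodge.
[cite: CharlesSchnell2014Notes, §11.2.5 Conj. 11.2.17] -/
theorem not_hodgeConjecture_of_not_boundaryAbsoluteness
    (hAH : ∀ ⦃n : ℕ⦄ ⦃X : SchemeOver ℂ⦄, IsSmoothProjective n X →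
      ∀ (p : ℕ) (c : complexBetti X (2 * p)), IsRationalClass c → IsOfHodgeType n X (2 * p) p p c →
        c ∈ algebraicClasses X p → IsAbsoluteHodgeClass n X p c)
    (h : ¬ BoundaryAbsoluteness) : ¬ _root_.HodgeConjecture :=
  fun hHC ↦ h (boundaryAbsoluteness_of_hodgeConjecture hAH hHC)

/-- **What any proof must build.** Fed the zero class (rational, and of type `(p,p)` by the tree
theorem `nonempty_hodgeModel_holds`), the crux turns "`0` is absolute Hodge on each covering piece
`Y_i`" (conjugation charts on the `Y_i`, single-valued at `0`) into a conjugation chart on every smooth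
projective fibre `X_t`, for every `σ ∈ Aut ℂ` — Jouanolou's device + GAGA + de Rham + Grothendieck's
comparison, none constructed in the tree. [cite: Jouanolou1973, Lemme 1.5] -/
theorem nonempty_conjugationChart_fibre_of_boundaryAbsoluteness (hB : BoundaryAbsoluteness)
    {N p : ℕ} {𝒳 C : SchemeOver ℂ} (f : 𝒳 ⟶ C) (o : AlgPoints C ℂ) (h𝒳 : IsSmoothProjective N 𝒳)
    (hC : IsSmoothProjective 1 C) (hf : Function.Surjective f.left.base) {ι : Type} [Finite ι]
    {m : ι → ℕ} {Y : ι → SchemeOver ℂ} (g : ∀ i, Y i ⟶ fiberOver f o)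
    (hY : ∀ i, IsSmoothProjective (m i) (Y i))
    (hcov : ∀ x : ↥(fiberOver f o).left, ∃ (i : ι) (y : ↥(Y i).left), (g i).left.base y = x)
    (h0 : ∀ i, IsAbsoluteHodgeClass (m i) (Y i) p 0) (t : AlgPoints C ℂ) {n : ℕ}
    (ht : IsSmoothProjective n (fiberOver f t)) (σ : ℂ ≃+* ℂ) :
    Nonempty (ConjugationChart σ (fiberOver f t) (2 * p)) := by
  have key := hB N p 𝒳 C f o h𝒳 hC hf ι m Y g hY hcov 0 IsRationalClass.zero
    (isOfHodgeType_zero_of_isSmoothProjective nonempty_hodgeModel_holds h𝒳 _ _ _)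
    (fun i ↦ by rw [map_zero]; exact h0 i) t n ht
  rw [map_zero] at key
  obtain ⟨_, D, _⟩ := (key.2.2 σ).1
  exact ⟨D⟩

end Summit.HodgeConjecture.HodgeConjecture.Theorems.BoundaryAbsoluteness.Negative
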